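import Literature.Geometry.Kaehler.HolomorphicChainLelongProofs
import Literature.Geometry.Kaehler.ComplexTorusPointCycleClass
import HarnessLib

/-!
# Zero-dimensional analytic sets are discrete

Layer `Literature/Geometry/Kaehler`; lane `lit-hodgefound`, seat p07, programme «DIMENSION OF
INTERSECTIONS», file 5. In [Chirka1989, §12.1] the intersection theory of analytic sets
`A₁, …, A_k` of complementary dimensions starts from the standing assumption *"2. `⋂ A_j` is
zero-dimensional (the minimal possible dimension)"*, used in the form: the points of `⋂ A_j` are
isolated, finitely many on every compact set. This file records that dictionary for an analytic
subset `Z` of a complex manifold `M` (modelled on the `n`-dimensional space `E`): a point `a ∈ Z`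
is isolated in `Z` iff it is a regular point of `Z` of codimension `n` [Chirka1989, §2.3: "`dim_a A
= 0` means that `a` is an isolated point of `A`"], `Z` has pure dimension `0` iff all its points are
isolated, and then `Z` meets every compact set in finitely many points.

* `isRegularPointOfCodim_finrank_of_inter_subset_singleton` — an isolated point of `Z` is a
  regular point of codimension `n` (the tree's `isRegularPointOfCodim_singleton` transported by
  `IsRegularPointOfCodim.congr_set`); with the tree's converse
  `IsRegularPointOfCodim.exists_nhds_inter_subset_singleton`:
  `isRegularPointOfCodim_finrank_iff_isolated`;
* `HasPureDim.exists_nhds_inter_subset_singleton_of_zero` — the points of a zero-dimensional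
  analytic set are isolated (every point is regular, `HasPureDim.mem_regularLocus_of_zero`);
* `hasPureDim_zero_of_forall_isolated`, `hasPureDim_zero_iff_forall_isolated` — **`dim Z = 0` iff
  all points of `Z` are isolated**;
* `finite_inter_of_isCompact_of_forall_isolated`, `HasPureDim.finite_inter_of_isCompact_of_zero`
  — **a zero-dimensional analytic set meets every compact set in a finite set**.

Theorems only; no new definitions, no named facts.

## References

* [Chirka1989] E. M. Chirka, *Complex Analytic Sets*, Kluwer 1989, §2.3 (p. 23), §12.1 (p. 136)
  (held `book:chirkand-complex-analytic-sets`, PDF p0151).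
-/

noncomputable section

open scoped Manifold Topology
open Set Filter Function

namespace Literature.Geometry.Kaehler

variable {E : Type*} [NormedAddCommGroup E] [NormedSpace ℂ E] [FiniteDimensional ℂ E]
  {M : Type*} [TopologicalSpace M] [ChartedSpace E M] [IsManifold 𝓘(ℂ, E) 1 M]

/-! ### Isolated points are the regular points of codimension `n` -/

/-- **An isolated point of `Z` is a regular point of `Z` of codimension `n = dim M`**: if
`Z ∩ U ⊆ {a}` for an open `U ∋ a` and `a ∈ Z`, then near `a` the set `Z` is the point `{a}`, cut
out by the `n` coordinates of a chart centred at `a`. [cite: Chirka1989, §2.3, p. 23] -/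
theorem isRegularPointOfCodim_finrank_of_inter_subset_singleton {Z U : Set M} {a : M}
    (hU : IsOpen U) (haU : a ∈ U) (haZ : a ∈ Z) (h : Z ∩ U ⊆ {a}) :
    IsRegularPointOfCodim 𝓘(ℂ, E) Z (Module.finrank ℂ E) a := by
  refine (isRegularPointOfCodim_singleton a).congr_set hU haU ?_
  ext y
  constructor
  · rintro ⟨hy, hyU⟩
    rw [mem_singleton_iff] at hy
    subst hy
    exact ⟨haZ, hyU⟩
  · rintro ⟨hyZ, hyU⟩
    exact ⟨h ⟨hyZ, hyU⟩, hyU⟩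

/-- Neighbourhood form: if some neighbourhood of `a ∈ Z` meets `Z` only in `a`, then `a` is a
regular point of `Z` of codimension `n`. [cite: Chirka1989, §2.3, p. 23] -/
theorem isRegularPointOfCodim_finrank_of_isolated {Z : Set M} {a : M} (haZ : a ∈ Z)
    (h : ∃ U ∈ 𝓝 a, U ∩ Z ⊆ {a}) : IsRegularPointOfCodim 𝓘(ℂ, E) Z (Module.finrank ℂ E) a := by
  obtain ⟨U, hU, hUZ⟩ := h
  obtain ⟨O, hOU, hO, haO⟩ := mem_nhds_iff.1 hU
  exact isRegularPointOfCodim_finrank_of_inter_subset_singleton hO haO haZ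
    fun y ⟨hyZ, hyO⟩ => hUZ ⟨hOU hyO, hyZ⟩

/-- **`a ∈ Z` is isolated in `Z` iff it is a regular point of `Z` of codimension `n`** ("`dim_a Z
= 0`"; the converse direction is the inverse function theorem,
`IsRegularPointOfCodim.exists_nhds_inter_subset_singleton`). [cite: Chirka1989, §2.3, p. 23] -/
theorem isRegularPointOfCodim_finrank_iff_isolated {Z : Set M} {a : M} (haZ : a ∈ Z) :
    IsRegularPointOfCodim 𝓘(ℂ, E) Z (Module.finrank ℂ E) a ↔ ∃ U ∈ 𝓝 a, U ∩ Z ⊆ {a} :=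
  ⟨fun h => h.exists_nhds_inter_subset_singleton haZ,
    isRegularPointOfCodim_finrank_of_isolated haZ⟩

/-! ### Zero-dimensional analytic sets -/

/-- **The points of a zero-dimensional analytic set are isolated**: every point of `Z` is a regular
point (`HasPureDim.mem_regularLocus_of_zero`, [Chirka1989, §5.1 Thm. (1)]), of codimension `n`,
hence isolated. [cite: Chirka1989, §2.3, p. 23; §12.1, p. 136] -/
theorem HasPureDim.exists_nhds_inter_subset_singleton_of_zero [LocallyCompactSpace M] [T2Space M]
    {Z : Set M} (h : HasPureDim 𝓘(ℂ, E) Z 0) {a : M} (ha : a ∈ Z) :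
    ∃ U ∈ 𝓝 a, U ∩ Z ⊆ {a} := by
  have hreg := h.mem_regularLocus_of_zero ha
  obtain ⟨c, hc, hZc⟩ := h
  rw [zero_add] at hc
  subst hc
  exact (hZc.2.2 a hreg).exists_nhds_inter_subset_singleton ha

/-- **A nonempty analytic set all of whose points are isolated has pure dimension `0`** (each of
its regular points is regular of codimension `n`). [cite: Chirka1989, §2.3, p. 23] -/
theorem hasPureDim_zero_of_forall_isolated {Z : Set M} (hZ : IsAnalyticSet 𝓘(ℂ, E) Z)
    (hne : Z.Nonempty) (h : ∀ a ∈ Z, ∃ U ∈ 𝓝 a, U ∩ Z ⊆ {a}) : HasPureDim 𝓘(ℂ, E) Z 0 :=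
  ⟨Module.finrank ℂ E, zero_add _, hZ, hne, fun x hx =>
    isRegularPointOfCodim_finrank_of_isolated hx.1 (h x hx.1)⟩

/-- **`dim Z = 0` iff all points of `Z` are isolated**, for a nonempty analytic set `Z`.
[cite: Chirka1989, §2.3, p. 23; §12.1, p. 136] -/
theorem hasPureDim_zero_iff_forall_isolated [LocallyCompactSpace M] [T2Space M] {Z : Set M}
    (hZ : IsAnalyticSet 𝓘(ℂ, E) Z) (hne : Z.Nonempty) :
    HasPureDim 𝓘(ℂ, E) Z 0 ↔ ∀ a ∈ Z, ∃ U ∈ 𝓝 a, U ∩ Z ⊆ {a} :=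
  ⟨fun h _ ha => h.exists_nhds_inter_subset_singleton_of_zero ha,
    hasPureDim_zero_of_forall_isolated hZ hne⟩

/-! ### Finiteness on compact sets -/

omit [FiniteDimensional ℂ E] [IsManifold 𝓘(ℂ, E) 1 M] in
/-- **A closed set all of whose points are isolated meets every compact set in finitely many
points** (cover `Z ∩ K` by isolating neighbourhoods and extract a finite subcover).
[cite: Chirka1989, §12.1, p. 136] -/
theorem finite_inter_of_isCompact_of_forall_isolated {Z : Set M} (hZ : IsClosed Z)
    (h : ∀ a ∈ Z, ∃ U ∈ 𝓝 a, U ∩ Z ⊆ {a}) {K : Set M} (hK : IsCompact K) : (Z ∩ K).Finite := by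
  classical
  choose! U hU hUZ using h
  have hS : IsCompact (Z ∩ K) := by
    rw [inter_comm]
    exact hK.inter_right hZ
  obtain ⟨t, hts, hcover⟩ := hS.elim_nhds_subcover U fun x hx => hU x hx.1
  refine t.finite_toSet.subset fun y hy => ?_
  obtain ⟨x, hxt, hyx⟩ := mem_iUnion₂.1 (hcover hy)
  have hyx' : y ∈ U x ∩ Z := ⟨hyx, hy.1⟩
  rw [mem_singleton_iff.1 (hUZ x (hts x hxt).1 hyx')]
  exact hxt

/-- **A zero-dimensional analytic set meets every compact set in a finite set.**
[cite: Chirka1989, §12.1, p. 136] -/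
theorem HasPureDim.finite_inter_of_isCompact_of_zero [LocallyCompactSpace M] [T2Space M]
    {Z : Set M} (h : HasPureDim 𝓘(ℂ, E) Z 0) {K : Set M} (hK : IsCompact K) : (Z ∩ K).Finite :=
  finite_inter_of_isCompact_of_forall_isolated h.isAnalyticSet.isClosed
    (fun _ ha => h.exists_nhds_inter_subset_singleton_of_zero ha) hK

/-- In particular **a zero-dimensional analytic subset of a compact complex manifold is finite.**
[cite: Chirka1989, §12.1, p. 136] -/
theorem HasPureDim.finite_of_zero [CompactSpace M] [T2Space M] {Z : Set M}
    (h : HasPureDim 𝓘(ℂ, E) Z 0) : Z.Finite := by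
  simpa using h.finite_inter_of_isCompact_of_zero isCompact_univ

/-- A zero-dimensional analytic set is locally finite: every point of `M` has a neighbourhood
meeting `Z` in finitely many points. [cite: Chirka1989, §12.1, p. 136] -/
theorem HasPureDim.exists_nhds_inter_finite_of_zero [LocallyCompactSpace M] [T2Space M]
    {Z : Set M} (h : HasPureDim 𝓘(ℂ, E) Z 0) (x : M) : ∃ U ∈ 𝓝 x, (Z ∩ U).Finite := by
  obtain ⟨K, hK, hKx⟩ := exists_compact_mem_nhds x
  exact ⟨K, hKx, h.finite_inter_of_isCompact_of_zero hK⟩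

end Literature.Geometry.Kaehler
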